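import Literature.NumberTheory.Automorphic.SpreadPairDatum
import Literature.NumberTheory.Automorphic.TorusPairIntegrandThinSupport
import Literature.NumberTheory.Automorphic.UnitBoxPairIntegralAveraging
import Literature.NumberTheory.Automorphic.RankinSelbergUnfoldedEulerCuspidalPairsThin
import Literature.NumberTheory.Automorphic.ArchPolyGaussianDecomposition
import Literature.NumberTheory.Automorphic.ArchRankinSelbergTestVector
import Literature.NumberTheory.Automorphic.PairLFunctionNeConjGlobalRankinSelberg
import Literature.NumberTheory.Automorphic.PairLFunctionPolesEqConjLandau
import Literature.NumberTheory.Automorphic.PairLFunctionPolesEqConjThinFirstMoment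
import Mathlib.Analysis.SpecialFunctions.Gamma.Deligne
import HarnessLib

/-!
# Arthur–Clozel (2.3) — the pole of `L^S(s, π × π̃)` at `s = 1` — from the archimedean test vectors of
# Humphries–Jo and Landau's lemma (proofs only)

Topic `NumberTheory/Automorphic`; namespace `Literature.NumberTheory.Automorphic`. Proof file (theorems
only) under the named fact `JacquetShalika1981_partialPairL_pole_of_eq_conj` of `PairLFunctionPoles`
(Arthur–Clozel (1989), Ch. 3 §2 (2.3); Jacquet–Shalika (1981), Thm. (5.3), II Prop. (3.6)): for unitary
cuspidal `π ≅ σ̃` on `GL_n(𝔸_K)`, `lim_{s → 1⁺} (s - 1) L^S(s, π ⊗ σ)` exists and is `≠ 0`. It is proved here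
in every rank from ONE archimedean input, the named fact `HumphriesJo2024_archRankinSelberg_testVector`
(`ArchRankinSelbergTestVector`; Humphries–Jo (2024), Thm. 1.1 / Thm. 5.6: `K_∞`-finite test vectors
`e, e'` and a polynomial-times-Gaussian `Φ_∞` with `Ψ_∞(s; W_e, W̄_{e'}, Φ_∞) = c^s ∏ Γ_ℝ(s + a_j) ∏ Γ_ℂ(s + b_j)`),
by the following route (the CONTINUATION half of the printed proof with the residue computation replaced
by Jacquet–Shalika's positivity argument, `PairLFunctionPolesEqConjLandau`):

1. realise `(e, e')` globally inside `π` by ONE spread intertwiner `T_sp` at a common level `K_f(𝔫)`, with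
   a common fixing test function `η` (`exists_spreadPairDatum`), so that the Whittaker coefficients of the
   two cusp forms factor as `W(g) = Λ₀(g_f T_sp) ℓ_∞(τ(g_∞) e)` (`whittakerCoeff_eq_finWhittaker_mul_transferMap`);
2. for each of the four non-negative Schwartz pieces `Φ_j` of `Φ_∞` (`ArchPolyGaussianDecomposition`) the
   global Rankin–Selberg integral of the pair with the thin test function `Φ_j ⊗ 𝟙_{thin}` has an entire
   continuation `F_j` (`RankinSelbergIntegralEntire`), unfolds on `1 < Re s < 2` and factors
   (`RankinSelbergUnfoldedEulerCuspidalPairsThin`) as `s (s-1) C L^{S'}(s, π × π̄) · (bad part)`; the bad part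
   collapses to the unit box (`TorusPairIntegrandThinSupport`) and, the finite factor being locally constant,
   averages to `c_F Ψ_∞(s; e, e', Φ_j)` (`UnitBoxPairIntegralAveraging`), with ONE constant `c_F ≠ 0`;
3. by linearity and Humphries–Jo, `F = F₁ - F₂ + i F₃ - i F₄` satisfies
   `F(s) = s (s-1) C c_F L^{S'}(s) c^s ∏ Γ_ℝ ∏ Γ_ℂ` on the strip, so `G = F · (c^s ∏ Γ_ℝ ∏ Γ_ℂ)⁻¹ / (C c_F)` is
   ENTIRE (`1/Γ` is entire) and equals `s (s-1) L^{S'}(s, π × π̄)` on `Re s > 1` (identity theorem);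
4. `G(1) ≠ 0` by `partialPairL_conjFamily_continuation_apply_one_ne_zero` (Landau), whence the one-family
   datum of `JacquetShalika1981_partialPairL_pole_of_eq_conj_of_one_family'`.

## Main statements

* `exists_entire_eq_partialPairL_conjFamily_of_humphriesJo`: step 1–3 in rank `n + 1`.
* `JacquetShalika1981_partialPairL_pole_of_eq_conj_of_humphriesJo`: the named fact in rank `n + 1`.
* `JacquetShalika1981_partialPairL_pole_of_eq_conj_of_humphriesJo'`: every rank.

## References

* J. Arthur, L. Clozel, *Simple algebras, base change, and the advanced theory of the trace formula*,
  Ann. of Math. Stud. 120 (1989), Ch. 3 §2, (2.3) [ArthurClozelAMS120].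
* H. Jacquet, J. A. Shalika, *On Euler products and the classification of automorphic representations
  I, II*, Amer. J. Math. 103 (1981), I §4–§5, Thm. (5.3); II Prop. (3.6) [JacquetShalikaAJM1981].
* P. Humphries, Y. Jo, *Test vectors for archimedean period integrals*, Publ. Mat. 68 (2024), Thm. 1.1,
  Thm. 5.6 [HumphriesJo2024].
* J. W. Cogdell, *Analytic theory of L-functions for GL_n* (2004), §2.3, §3.2, §4.1–4.2 [CogdellAnalyticTheory2004].
-/

noncomputable section

open MeasureTheory Measure NumberField NumberField.mixedEmbedding IsDedekindDomain Set Filter Topology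
open scoped MatrixGroups ENNReal NNReal ComplexConjugate Classical
open Literature.NumberTheory.GaloisRepresentations (ideleGroup)

namespace Literature.NumberTheory.Automorphic

/-! ### Analysis: the inverse Gamma factor, and the entire function from four pieces -/

section Analysis

/-- **The inverse of Humphries–Jo's Gamma factor is entire**: for `c > 0` and shifts with
`Re a_j, Re b_j > -1` there is an entire `E` with `E(s) · (c^s ∏ Γ_ℝ(s + a_j) ∏ Γ_ℂ(s + b_j)) = 1` for
`Re s > 1` (`1/Γ` is entire, Mathlib `Complex.differentiable_Gammaℝ_inv`; `Γ_ℂ(s) = Γ_ℝ(s) Γ_ℝ(s + 1)`).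
[folklore] -/
theorem exists_entire_inv_gammaFactor {c : ℝ} (hc : 0 < c) {d₁ d₂ : ℕ} (a : Fin d₁ → ℂ) (b : Fin d₂ → ℂ)
    (ha : ∀ j, -1 < (a j).re) (hb : ∀ j, -1 < (b j).re) :
    ∃ E : ℂ → ℂ, Differentiable ℂ E ∧ ∀ s : ℂ, 1 < s.re →
      E s * ((c : ℂ) ^ s * ((∏ j, Complex.Gammaℝ (s + a j)) * ∏ j, Complex.Gammaℂ (s + b j))) = 1 := by
  have hc0 : (c : ℂ) ≠ 0 := Complex.ofReal_ne_zero.2 hc.ne'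
  refine ⟨fun s => (c : ℂ) ^ (-s) * ((∏ j, (Complex.Gammaℝ (s + a j))⁻¹) *
    ∏ j, ((Complex.Gammaℝ (s + b j))⁻¹ * (Complex.Gammaℝ (s + b j + 1))⁻¹)), ?_, fun s hs => ?_⟩
  · refine Differentiable.mul (fun s => (differentiableAt_id.neg.const_cpow (Or.inl hc0))) (Differentiable.mul ?_ ?_)
    · have h : (fun s : ℂ => ∏ j, (Complex.Gammaℝ (s + a j))⁻¹) = ∏ j, fun s : ℂ => (Complex.Gammaℝ (s + a j))⁻¹ := by
        funext s; simp only [Finset.prod_apply]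
      rw [h]
      exact Differentiable.finsetProd fun j _ =>
        Complex.differentiable_Gammaℝ_inv.comp (differentiable_id.add_const _)
    · have h : (fun s : ℂ => ∏ j, ((Complex.Gammaℝ (s + b j))⁻¹ * (Complex.Gammaℝ (s + b j + 1))⁻¹)) =
          ∏ j, fun s : ℂ => (Complex.Gammaℝ (s + b j))⁻¹ * (Complex.Gammaℝ (s + b j + 1))⁻¹ := by
        funext s; simp only [Finset.prod_apply]
      rw [h]
      exact Differentiable.finsetProd fun j _ =>
        (Complex.differentiable_Gammaℝ_inv.comp (differentiable_id.add_const _)).mul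
          (Complex.differentiable_Gammaℝ_inv.comp ((differentiable_id.add_const _).add_const _))
  · have hΓℝ : ∀ j, Complex.Gammaℝ (s + a j) ≠ 0 := fun j =>
      Complex.Gammaℝ_ne_zero_of_re_pos (by rw [Complex.add_re]; linarith [ha j])
    have hΓb : ∀ j, Complex.Gammaℝ (s + b j) ≠ 0 := fun j =>
      Complex.Gammaℝ_ne_zero_of_re_pos (by rw [Complex.add_re]; linarith [hb j])
    have hΓb1 : ∀ j, Complex.Gammaℝ (s + b j + 1) ≠ 0 := fun j =>
      Complex.Gammaℝ_ne_zero_of_re_pos (by rw [Complex.add_re, Complex.add_re, Complex.one_re]; linarith [hb j])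
    have hΓℂ : ∀ j, Complex.Gammaℂ (s + b j) = Complex.Gammaℝ (s + b j) * Complex.Gammaℝ (s + b j + 1) := fun j =>
      (Complex.Gammaℝ_mul_Gammaℝ_add_one _).symm
    have h1 : (c : ℂ) ^ (-s) * (c : ℂ) ^ s = 1 := by
      rw [Complex.cpow_neg, inv_mul_cancel₀]
      rw [Ne, Complex.cpow_eq_zero_iff, not_and_or]
      exact Or.inl hc0
    have h2 : (∏ j, (Complex.Gammaℝ (s + a j))⁻¹) * ∏ j, Complex.Gammaℝ (s + a j) = 1 := by
      rw [Finset.prod_inv_distrib, inv_mul_cancel₀ (Finset.prod_ne_zero_iff.2 fun j _ => hΓℝ j)]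
    have h3 : (∏ j, ((Complex.Gammaℝ (s + b j))⁻¹ * (Complex.Gammaℝ (s + b j + 1))⁻¹)) * ∏ j, Complex.Gammaℂ (s + b j) = 1 := by
      rw [← Finset.prod_mul_distrib, Finset.prod_eq_one]
      intro j _
      rw [hΓℂ j]
      field_simp [hΓb j, hΓb1 j]
    calc (c : ℂ) ^ (-s) * ((∏ j, (Complex.Gammaℝ (s + a j))⁻¹) *
          ∏ j, ((Complex.Gammaℝ (s + b j))⁻¹ * (Complex.Gammaℝ (s + b j + 1))⁻¹)) *
          ((c : ℂ) ^ s * ((∏ j, Complex.Gammaℝ (s + a j)) * ∏ j, Complex.Gammaℂ (s + b j)))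
        = ((c : ℂ) ^ (-s) * (c : ℂ) ^ s) * (((∏ j, (Complex.Gammaℝ (s + a j))⁻¹) * ∏ j, Complex.Gammaℝ (s + a j)) *
            ((∏ j, ((Complex.Gammaℝ (s + b j))⁻¹ * (Complex.Gammaℝ (s + b j + 1))⁻¹)) * ∏ j, Complex.Gammaℂ (s + b j))) := by
          ring
      _ = 1 := by rw [h1, h2, h3]; ring

/-- **The entire function from the four pieces.** If `F₁, …, F₄` are entire with
`F_j(s) = s (s-1) · C · L(s) · c_F · Ψ_j(s)` on the strip `1 < Re s < 2`, `C c_F ≠ 0`,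
`H = Ψ₁ - Ψ₂ + i (Ψ₃ - Ψ₄)` on `Re s > 1`, `E` entire with `E H = 1` on `Re s > 1`, and `L` holomorphic on
`Re s > 1`, then `G = (F₁ - F₂ + i (F₃ - F₄)) · E / (C c_F)` is entire and `G(s) = s (s-1) L(s)` for
`Re s > 1` (identity theorem from the strip). [folklore] -/
theorem exists_entire_eq_of_pieces {L H E : ℂ → ℂ} {C cF : ℂ} (hC : C ≠ 0) (hcF : cF ≠ 0)
    {F₁ F₂ F₃ F₄ Ψ₁ Ψ₂ Ψ₃ Ψ₄ : ℂ → ℂ}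
    (hF₁ : Differentiable ℂ F₁) (hF₂ : Differentiable ℂ F₂) (hF₃ : Differentiable ℂ F₃) (hF₄ : Differentiable ℂ F₄)
    (h₁ : ∀ s : ℂ, 1 < s.re → s.re < 2 → F₁ s = s * (s - 1) * (C * (L s * (cF * Ψ₁ s))))
    (h₂ : ∀ s : ℂ, 1 < s.re → s.re < 2 → F₂ s = s * (s - 1) * (C * (L s * (cF * Ψ₂ s))))
    (h₃ : ∀ s : ℂ, 1 < s.re → s.re < 2 → F₃ s = s * (s - 1) * (C * (L s * (cF * Ψ₃ s))))
    (h₄ : ∀ s : ℂ, 1 < s.re → s.re < 2 → F₄ s = s * (s - 1) * (C * (L s * (cF * Ψ₄ s))))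
    (hH : ∀ s : ℂ, 1 < s.re → H s = (Ψ₁ s - Ψ₂ s) + Complex.I * (Ψ₃ s - Ψ₄ s))
    (hE : Differentiable ℂ E) (hEH : ∀ s : ℂ, 1 < s.re → E s * H s = 1)
    (hL : DifferentiableOn ℂ L {s : ℂ | 1 < s.re}) :
    ∃ G : ℂ → ℂ, Differentiable ℂ G ∧ ∀ s : ℂ, 1 < s.re → G s = s * (s - 1) * L s := by
  set G : ℂ → ℂ := fun s => ((F₁ s - F₂ s) + Complex.I * (F₃ s - F₄ s)) * E s * (C * cF)⁻¹ with hG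
  have hGd : Differentiable ℂ G :=
    ((((hF₁.sub hF₂).add ((hF₃.sub hF₄).const_mul _)).mul hE).mul_const _)
  refine ⟨G, hGd, ?_⟩
  -- on the strip
  have hstrip : ∀ s : ℂ, 1 < s.re → s.re < 2 → G s = s * (s - 1) * L s := by
    intro s hs1 hs2
    have hCcF : C * cF ≠ 0 := mul_ne_zero hC hcF
    simp only [hG]
    rw [h₁ s hs1 hs2, h₂ s hs1 hs2, h₃ s hs1 hs2, h₄ s hs1 hs2]
    have e1 : (s * (s - 1) * (C * (L s * (cF * Ψ₁ s))) - s * (s - 1) * (C * (L s * (cF * Ψ₂ s))) +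
        Complex.I * (s * (s - 1) * (C * (L s * (cF * Ψ₃ s))) - s * (s - 1) * (C * (L s * (cF * Ψ₄ s))))) *
        E s * (C * cF)⁻¹ = s * (s - 1) * L s * (E s * ((Ψ₁ s - Ψ₂ s) + Complex.I * (Ψ₃ s - Ψ₄ s))) * ((C * cF) * (C * cF)⁻¹) := by
      ring
    rw [e1, ← hH s hs1, hEH s hs1, mul_inv_cancel₀ hCcF]
    ring
  -- identity theorem on `Re s > 1`
  set U : Set ℂ := {s : ℂ | 1 < s.re} with hU
  have hUo : IsOpen U := isOpen_lt continuous_const Complex.continuous_re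
  have hUc : IsPreconnected U := by
    have hUeq : U = Complex.reLm ⁻¹' Set.Ioi (1 : ℝ) := by
      ext z; simp only [hU, Set.mem_setOf_eq, Set.mem_preimage, Set.mem_Ioi, Complex.reLm_coe]
    rw [hUeq]
    exact ((convex_Ioi (1 : ℝ)).linear_preimage Complex.reLm).isPreconnected
  have hR : DifferentiableOn ℂ (fun s : ℂ => s * (s - 1) * L s) U :=
    ((differentiableOn_id.mul (differentiableOn_id.sub_const 1)).mul hL)
  have z₀mem : ((3 / 2 : ℝ) : ℂ) ∈ U := by
    simp only [hU, Set.mem_setOf_eq, Complex.ofReal_re]; norm_num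
  have hev : G =ᶠ[𝓝 ((3 / 2 : ℝ) : ℂ)] fun s : ℂ => s * (s - 1) * L s := by
    have hV : {s : ℂ | 1 < s.re ∧ s.re < 2} ∈ 𝓝 ((3 / 2 : ℝ) : ℂ) := by
      refine ((isOpen_lt continuous_const Complex.continuous_re).inter
        (isOpen_lt Complex.continuous_re continuous_const)).mem_nhds ⟨?_, ?_⟩ <;>
        simp only [Set.mem_setOf_eq, Complex.ofReal_re] <;> norm_num
    filter_upwards [hV] with s hs
    exact hstrip s hs.1 hs.2
  have hEq := (hGd.differentiableOn.analyticOnNhd hUo).eqOn_of_preconnected_of_eventuallyEq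
    (hR.analyticOnNhd hUo) hUc z₀mem hev
  exact fun s hs => hEq hs

end Analysis

/-! ### Linearity of the archimedean pair integral in the complex test function -/

section ArchLinear

variable {n : ℕ} {K : Type} [Field K] [NumberField K]
variable (hcpt : isCompact_glFiniteIntegralLevel n K)
  {E : Type*} [NormedAddCommGroup E] [NormedSpace ℂ E] [CompleteSpace E]
  {E' : Type*} [NormedAddCommGroup E'] [NormedSpace ℂ E'] [CompleteSpace E']
  (τ : ContRepresentation ℂ (AutomorphyDatum.gl n K hcpt).arch.carrier E) (hτ : τ.IsStronglyContinuous)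
  (τ' : ContRepresentation ℂ (AutomorphyDatum.gl n K hcpt).arch.carrier E') (hτ' : τ'.IsStronglyContinuous)

/-- **`Ψ_∞` is linear in `Φ_∞` along the decomposition `Φ_∞ = (Φ₁ - Φ₂) + i (Φ₃ - Φ₄)`**, as soon as the
four integrands are integrable. [folklore] -/
theorem archRankinSelbergPairIntegralCplx_decomposition (ℓ : archGardingSpace hcpt τ →ₗ[ℂ] ℂ)
    (ℓ' : archGardingSpace hcpt τ' →ₗ[ℂ] ℂ) (e : archGardingSpace hcpt τ) (e' : archGardingSpace hcpt τ')
    {Φ : (Fin n → InfiniteAdeleRing K) → ℂ} {Φ₁ Φ₂ Φ₃ Φ₄ : (Fin n → InfiniteAdeleRing K) → ℝ}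
    (hΦ : ∀ z, Φ z = (((Φ₁ z : ℝ) : ℂ) - Φ₂ z) + Complex.I * (((Φ₃ z : ℝ) : ℂ) - Φ₄ z))
    [MeasurableSpace (GL (Fin n) (mixedSpace K))] [MeasurableSpace ((mixedSpace K)ˣ)]
    (μA : Measure (Fin n → (mixedSpace K)ˣ)) (μK : Measure ↥(Kinf n K)) (s : ℂ)
    (hint : ∀ Ψ ∈ [Φ₁, Φ₂, Φ₃, Φ₄], Integrable (fun p : (Fin n → (mixedSpace K)ˣ) × ↥(Kinf n K) =>
        ℓ ⟨τ (toArch hcpt (glDiagonal n (mixedSpace K) p.1 * (p.2 : GL (Fin n) (mixedSpace K)))) (e : E),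
            apply_mem_archGardingSpace hτ _ e.2⟩ *
          conj (ℓ' ⟨τ' (toArch hcpt (glDiagonal n (mixedSpace K) p.1 * (p.2 : GL (Fin n) (mixedSpace K))))
            (e' : E'), apply_mem_archGardingSpace hτ' _ e'.2⟩) *
          ((Ψ (archLastRow n K (glDiagonal n (mixedSpace K) p.1 * (p.2 : GL (Fin n) (mixedSpace K)))) : ℝ) : ℂ) *
          archTorusWeightC n K s p.1) (μA.prod μK)) :
    archRankinSelbergPairIntegralCplx hcpt τ hτ τ' hτ' ℓ ℓ' e e' Φ μA μK s =
      (archRankinSelbergPairIntegralCplx hcpt τ hτ τ' hτ' ℓ ℓ' e e' (fun z => ((Φ₁ z : ℝ) : ℂ)) μA μK s -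
        archRankinSelbergPairIntegralCplx hcpt τ hτ τ' hτ' ℓ ℓ' e e' (fun z => ((Φ₂ z : ℝ) : ℂ)) μA μK s) +
      Complex.I * (archRankinSelbergPairIntegralCplx hcpt τ hτ τ' hτ' ℓ ℓ' e e' (fun z => ((Φ₃ z : ℝ) : ℂ)) μA μK s -
        archRankinSelbergPairIntegralCplx hcpt τ hτ τ' hτ' ℓ ℓ' e e' (fun z => ((Φ₄ z : ℝ) : ℂ)) μA μK s) := by
  -- the four integrands
  set AB : (Fin n → (mixedSpace K)ˣ) × ↥(Kinf n K) → ℂ := fun p =>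
    ℓ ⟨τ (toArch hcpt (glDiagonal n (mixedSpace K) p.1 * (p.2 : GL (Fin n) (mixedSpace K)))) (e : E),
        apply_mem_archGardingSpace hτ _ e.2⟩ *
      conj (ℓ' ⟨τ' (toArch hcpt (glDiagonal n (mixedSpace K) p.1 * (p.2 : GL (Fin n) (mixedSpace K))))
        (e' : E'), apply_mem_archGardingSpace hτ' _ e'.2⟩) with hAB
  set r : (Fin n → (mixedSpace K)ˣ) × ↥(Kinf n K) → (Fin n → InfiniteAdeleRing K) := fun p =>
    archLastRow n K (glDiagonal n (mixedSpace K) p.1 * (p.2 : GL (Fin n) (mixedSpace K))) with hr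
  set X : ((Fin n → InfiniteAdeleRing K) → ℝ) → (Fin n → (mixedSpace K)ˣ) × ↥(Kinf n K) → ℂ := fun Ψ p =>
    AB p * ((Ψ (r p) : ℝ) : ℂ) * archTorusWeightC n K s p.1 with hX
  have h1 : Integrable (X Φ₁) (μA.prod μK) := hint Φ₁ (by simp)
  have h2 : Integrable (X Φ₂) (μA.prod μK) := hint Φ₂ (by simp)
  have h3 : Integrable (X Φ₃) (μA.prod μK) := hint Φ₃ (by simp)
  have h4 : Integrable (X Φ₄) (μA.prod μK) := hint Φ₄ (by simp)
  have hI : ∀ Ψ : (Fin n → InfiniteAdeleRing K) → ℝ,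
      archRankinSelbergPairIntegralCplx hcpt τ hτ τ' hτ' ℓ ℓ' e e' (fun z => ((Ψ z : ℝ) : ℂ)) μA μK s =
        ∫ p, X Ψ p ∂(μA.prod μK) := fun Ψ => rfl
  have hmain : archRankinSelbergPairIntegralCplx hcpt τ hτ τ' hτ' ℓ ℓ' e e' Φ μA μK s =
      ∫ p, ((X Φ₁ p - X Φ₂ p) + Complex.I * (X Φ₃ p - X Φ₄ p)) ∂(μA.prod μK) := by
    change ∫ p, AB p * Φ (r p) * archTorusWeightC n K s p.1 ∂(μA.prod μK) = _
    refine integral_congr_ae (Eventually.of_forall fun p => ?_)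
    simp only [hX, hΦ (r p)]
    ring
  have h12 : Integrable (fun p => X Φ₁ p - X Φ₂ p) (μA.prod μK) := h1.sub h2
  have h34 : Integrable (fun p => Complex.I * (X Φ₃ p - X Φ₄ p)) (μA.prod μK) := (h3.sub h4).const_mul Complex.I
  rw [hmain, integral_add h12 h34, integral_sub h1 h2, integral_const_mul, integral_sub h3 h4, hI, hI, hI, hI]

end ArchLinear

/-! ### The construction -/

section Main

open ValuativeRel

variable {n : ℕ} {K : Type} [Field K] [NumberField K]
variable {μ' : Measure (AdelicGroupData.gl (n + 1) K).automorphicQuotient}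
  [(AdelicGroupData.gl (n + 1) K).IsAutomorphicMeasure μ']

-- the automorphic quotient carries the tree's Borel σ-algebra (as in `RankinSelbergUnfoldingIdentity`)
attribute [-instance] Quotient.instMeasurableSpace QuotientGroup.measurableSpace

-- the house local instances (as in `PairLFunctionPolesEqConjArch` and `ArchRankinSelbergPairBridge`)
attribute [local instance] adelicBorel borelSpace_adelic locallyCompactSpace_adelic secondCountableTopology_gl_adelic
  glAdeleBorel borelSpace_glAdele glInfBorel borelSpace_glInf locallyCompactSpace_glInf secondCountableTopology_glInf

attribute [local instance] Literature.MeasureTheory.Group.hasSummableGeomSeries_of_finiteDimensional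
  Literature.MeasureTheory.Group.Units.borelSpace_of_isOpenEmbedding
  Literature.MeasureTheory.Group.Units.secondCountableTopology
  Literature.MeasureTheory.Group.Units.locallyCompactSpace

attribute [local instance] secondCountableTopology_ideleGroup borelSpace_pi_mixedUnits measurableMul_pi_mixedUnits

set_option maxHeartbeats 3200000 in
set_option synthInstance.maxHeartbeats 200000 in
set_option backward.isDefEq.respectTransparency false in
/-- **Steps 1–3: an entire continuation of `s (s-1) L^{S'}(s, π × π̄)` from Humphries–Jo's archimedean
test vectors** (rank `n + 1`): for every cuspidal `π` there are a finite `S'`, a Satake family `α` of `π`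
off `S'` and an ENTIRE `G` with `G(s) = s (s-1) · partialPairL S' α ᾱ s` for `Re s > 1`. See the module
docstring for the route. [cite: JacquetShalikaAJM1981, §4 and Thm. (5.3)] [cite: HumphriesJo2024, Thm. 1.1, Thm. 5.6]
[cite: CogdellAnalyticTheory2004, §2.3 Thm. 2.1–2.2, §4.1–4.2] -/
theorem exists_entire_eq_partialPairL_conjFamily_of_humphriesJo
    (hHJ : HumphriesJo2024_archRankinSelberg_testVector (n + 1) K) (P : CuspidalAutomorphicRepGL (n + 1) K μ') :
    ∃ (S' : Set (HeightOneSpectrum (𝓞 K))) (α : SatakeFamily K), S'.Finite ∧ IsSatakeFamilyOf P S' α ∧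
      ∃ G : ℂ → ℂ, Differentiable ℂ G ∧
        ∀ s : ℂ, 1 < s.re → G s = s * (s - 1) * partialPairL S' α (conjFamily α) s := by
  classical
  have hn : 0 < n + 1 := Nat.succ_pos n
  have hcpt : isCompact_glFiniteIntegralLevel (n + 1) K := isCompact_glFiniteIntegralLevel_holds (n + 1) K
  -- topological and measurable structures
  haveI : T2Space (GL (Fin (n + 1)) (AdeleRing (𝓞 K) K)) := t2Space_gl (n + 1) K
  haveI : LocallyCompactSpace (GL (Fin (n + 1)) (AdeleRing (𝓞 K) K)) :=
    AdelicGroupData.locallyCompactSpace_generalLinearGroup_adeleRing K (Fin (n + 1))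
  haveI := secondCountableTopology_generalLinearGroup_adeleRing K (Fin (n + 1))
  haveI : T2Space (AdeleRing (𝓞 K) K) := t2Space_adeleRing K
  letI : MeasurableSpace (AdeleRing (𝓞 K) K) := borel _
  haveI : BorelSpace (AdeleRing (𝓞 K) K) := ⟨rfl⟩
  haveI := borelSpace_ideleGroup K
  haveI := locallyCompactSpace_ideleGroup K
  haveI := secondCountableTopology_ideleGroup K
  haveI := secondCountableTopology_adeleRing K
  haveI := locallyCompactSpace_adeleRing' K
  haveI : CompactSpace ↥(maximalCompactAdelic (n + 1) K) :=
    isCompact_iff_compactSpace.1 (isCompact_maximalCompactAdelic (n + 1) K)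
  haveI : LocallyCompactSpace ↥(adelicUnipotent (n + 1) K) := (isClosed_adelicUnipotent (n + 1) K).locallyCompactSpace
  haveI : SecondCountableTopology (AdelicGroupData.gl (n + 1) K).Adelic :=
    secondCountableTopology_generalLinearGroup_adeleRing K (Fin (n + 1))
  haveI : SecondCountableTopology ↥(maximalCompactAdelic (n + 1) K) := TopologicalSpace.Subtype.secondCountableTopology _
  -- Haar measures and the image measures on the archimedean coordinates
  obtain ⟨νI, hνI⟩ := exists_isHaarMeasure_ideleGroup K
  haveI := hνI
  set νA : Measure (Fin (n + 1) → ideleGroup K) := Measure.haar with hνA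
  set νK : Measure ↥(maximalCompactAdelic (n + 1) K) := Measure.haar with hνK
  set ν₀ : Measure ↥(adelicUnipotent (n + 1) K) := Measure.haar with hν₀
  haveI hν₀R : ν₀.IsMulRightInvariant := isMulRightInvariant_of_isHaarMeasure_adelicUnipotent ν₀
  obtain ⟨μA, hμA⟩ : ∃ μA : Measure (Fin (n + 1) → (mixedSpace K)ˣ),
      μA = (νA.restrict (unitBox (Set.univ : Set (HeightOneSpectrum (𝓞 K))))).map (archTorusOfIdele (n + 1) K) :=
    ⟨_, rfl⟩
  obtain ⟨μK, hμK⟩ : ∃ μK : Measure ↥(Kinf (n + 1) K), μK = νK.map (kinfOfMaximalCompact (n + 1) K) := ⟨_, rfl⟩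
  haveI : IsHaarMeasure μA := by rw [hμA]; exact isHaarMeasure_map_archTorusOfIdele νA
  haveI : IsHaarMeasure μK := by rw [hμK]; exact isHaarMeasure_map_kinfOfMaximalCompact νK
  -- (1) a Satake family of `π` and the ramification of `ψ`
  obtain ⟨S₁, α, -, hα⟩ := exists_isSatakeFamilyOf_holds (n := n + 1) (K := K) (μ := μ') P
  obtain ⟨Sψ, hSψ⟩ := exists_finset_adicComponent_adeleAddChar_unramified (K := K)
  have hψ : IsGlobalAddChar K (adeleAddChar K) := isGlobalAddChar_adeleAddChar (K := K)
  -- (2) the archimedean component and the line datum of the finite Whittaker model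
  obtain ⟨E, _, _, _, τ, hτi, hτu, hτc, hex, -⟩ := exists_archComponent_decomposition (hcpt := hcpt) P
  set ℓ := whittakerFunctional ν₀ (continuous_adeleAddChar K) (ContRepresentation.Equiv.refl P.1.toContRep) with hℓ
  have hℓW : IsContWhittakerFunctional P.1 (adeleAddChar K) ℓ :=
    isContWhittakerFunctional_whittakerFunctional ν₀ (continuous_adeleAddChar K) hψ _
  have hℓ0 : ℓ ≠ 0 := by
    obtain ⟨T, hT, hT0⟩ := hex
    have hx : ∃ x : E, T x ≠ 0 := by
      by_contra h
      push Not at h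
      exact hT0 (ContinuousLinearMap.ext h)
    obtain ⟨x, hx⟩ := hx
    have hf0 : (⟨T x, hT.1 x⟩ : P.1.toSubmodule) ≠ 0 := fun h => hx (congrArg Subtype.val h)
    exact whittakerFunctional_refl_ne_zero hn ν₀ P.2.1 hf0
  obtain ⟨T₀, Λ₀, -, hΛ1, hne, hΛ⟩ := exists_finWhittaker_transferMap_eq_smul P hτu hτi hτc hex hℓW hℓ0
  set ℓi := transferMap ℓ hτc T₀ with hℓi
  have hℓiW : IsArchContWhittakerFunctional hcpt τ hτc ℓi :=
    transferMap_mem_archContWhittakerFunctionals hℓW hτc T₀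
  have hℓi0 : ℓi ≠ 0 := hne
  -- (3) Humphries–Jo's archimedean datum for `(τ, ℓ_∞; τ, ℓ_∞)` and the image Haar measures
  obtain ⟨⟨e, e', hefin, he'fin, Φi, hΦi, cH, hcH, d₁, d₂, a, b, ha, hb, hHJ'⟩, -⟩ :=
    hHJ hcpt E τ hτc hτu hτi ℓi hℓiW hℓi0 E τ hτc hτu hτi ℓi hℓiW hℓi0 μA inferInstance μK inferInstance
  -- (4) the four non-negative Schwartz pieces of `Φ_∞`
  obtain ⟨Φ₁, Φ₂, Φ₃, Φ₄, hpieces, hdecomp⟩ := hΦi.exists_nonneg_schwartz_decomposition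
  -- (5) the spread pair datum
  obtain ⟨T, hT₀T, m, 𝔫, h𝔫, hprimes, Tsp, η, hη, hηK, hm, hradius, hΛeq, hTsplev, hfix, hfix', hdata⟩ :=
    exists_spreadPairDatum P hτc ν₀ hne hΛ e e' hefin he'fin (S₁ ∪ Sψ)
  have hηc : Continuous η := hη.continuous
  have hηs : HasCompactSupport η := hη.hasCompactSupport
  have hΛsp : Λ₀ Tsp = 1 := by rw [hΛeq, hΛ1]
  -- the two cusp forms, their Whittaker coefficients and the product formulas
  set u : P.1.toSubmodule := ⟨(Tsp : E →L[ℂ] (AdelicGroupData.gl (n + 1) K).L2 μ') (e : E),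
    apply_mem_of_mem_multiplicityModule Tsp e⟩ with hu
  set u' : P.1.toSubmodule := ⟨(Tsp : E →L[ℂ] (AdelicGroupData.gl (n + 1) K).L2 μ') (e' : E),
    apply_mem_of_mem_multiplicityModule Tsp e'⟩ with hu'
  set W : GL (Fin (n + 1)) (AdeleRing (𝓞 K) K) → ℂ := whittakerCoeff ν₀ (unipotentTateDomain (n + 1) K) (adeleAddChar K)
    (invQuot (AdelicGroupData.gl (n + 1) K) (smoothedForm η (u : (AdelicGroupData.gl (n + 1) K).L2 μ'))) with hW
  set W' : GL (Fin (n + 1)) (AdeleRing (𝓞 K) K) → ℂ := whittakerCoeff ν₀ (unipotentTateDomain (n + 1) K) (adeleAddChar K)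
    (invQuot (AdelicGroupData.gl (n + 1) K) (smoothedForm η (u' : (AdelicGroupData.gl (n + 1) K).L2 μ'))) with hW'
  set A : GL (Fin (n + 1)) (mixedSpace K) → ℂ := fun h =>
    ℓi ⟨τ (toArch hcpt h) (e : E), apply_mem_archGardingSpace hτc _ e.2⟩ with hA
  set A' : GL (Fin (n + 1)) (mixedSpace K) → ℂ := fun h =>
    ℓi ⟨τ (toArch hcpt h) (e' : E), apply_mem_archGardingSpace hτc _ e'.2⟩ with hA'
  have hWprod : ∀ g, W g = Λ₀ (finComponentRep hcpt τ P.1 (GLn.sndHom (n + 1) K g) Tsp) * A (GLn.toMixed (n + 1) K g) :=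
    fun g => whittakerCoeff_eq_finWhittaker_mul_transferMap P hτc ν₀ hΛ Tsp e hη hfix g
  have hW'prod : ∀ g, W' g = Λ₀ (finComponentRep hcpt τ P.1 (GLn.sndHom (n + 1) K g) Tsp) * A' (GLn.toMixed (n + 1) K g) :=
    fun g => whittakerCoeff_eq_finWhittaker_mul_transferMap P hτc ν₀ hΛ Tsp e' hη hfix' g
  -- continuity of the archimedean Whittaker functions
  obtain ⟨U₀, hU₀o, hU₀c, hT₀U⟩ := T₀.2
  have hAc : Continuous A := continuous_transferMap_toArch hcpt hτc hU₀o hU₀c hT₀U ν₀ (continuous_adeleAddChar K) e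
  have hA'c : Continuous A' := continuous_transferMap_toArch hcpt hτc hU₀o hU₀c hT₀U ν₀ (continuous_adeleAddChar K) e'
  -- left `N`-equivariance and central insensitivity of `W`
  have hφinv : IsLeftInvariant (AdelicGroupData.gl (n + 1) K)
      (invQuot (AdelicGroupData.gl (n + 1) K) (smoothedForm η (u : (AdelicGroupData.gl (n + 1) K).L2 μ'))) :=
    isLeftInvariant_invQuot _ _
  have hWN : ∀ (x : ↥(adelicUnipotent (n + 1) K)) (g : GL (Fin (n + 1)) (AdeleRing (𝓞 K) K)),
      W ((x : GL (Fin (n + 1)) (AdeleRing (𝓞 K) K)) * g) = whittakerCharFun (adeleAddChar K) x * W g := fun x g =>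
    whittakerCoeff_unipotent_mul (ν := ν₀) (𝓕 := unipotentTateDomain (n + 1) K) (ψ := adeleAddChar K)
      (isFundamentalDomain_unipotentTateDomain ν₀) hψ hφinv x g
  obtain ⟨ω, hωu, -, -, -, -, hω⟩ := P.exists_centralCharacter_smoothedForm
  have hWZ : ∀ (z : ideleGroup K) (g : GL (Fin (n + 1)) (AdeleRing (𝓞 K) K)),
      ‖W (Matrix.GeneralLinearGroup.scalar (Fin (n + 1)) z * g)‖ = ‖W g‖ := by
    intro z g
    rw [hW, whittakerCoeff_scalar_mul (fun g => hω η u z g), norm_mul, hωu z, one_mul]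
  -- (6) the finite factor `F(g_f) = |Λ₀(g_f T_sp)|² 𝟙_{thin}(g_f)` and its level
  set Uf : Subgroup (GL (Fin (n + 1)) (FiniteAdeleRing (𝓞 K) K)) := finitePrincipalCongruenceLevel (n + 1) K 𝔫 with hUf
  have hUo : IsOpen (Uf : Set (GL (Fin (n + 1)) (FiniteAdeleRing (𝓞 K) K))) := isOpen_finitePrincipalCongruenceLevel (n + 1) K h𝔫
  have hUn : ∀ g ∈ glFiniteIntegralLevel (n + 1) K, ∀ x ∈ Uf, g * x * g⁻¹ ∈ Uf := by
    intro g hg x hx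
    have h := inv_mul_mul_mem_principalCongruenceLevel (mem_finitePrincipalCongruenceLevel_iff.1 hx)
      ((glFiniteIntegralLevel (n + 1) K).inv_mem hg)
    rw [← map_inv, inv_inv, ← map_mul, ← map_mul] at h
    exact mem_finitePrincipalCongruenceLevel_iff.2 h
  set Ff : GL (Fin (n + 1)) (FiniteAdeleRing (𝓞 K) K) → ℂ := fun g =>
    Λ₀ (finComponentRep hcpt τ P.1 g Tsp) * conj (Λ₀ (finComponentRep hcpt τ P.1 g Tsp)) *
      thinIndicatorGL (n + 1) K T m g with hFf
  have hfix_sp : ∀ x ∈ Uf, finComponentRep hcpt τ P.1 x Tsp = Tsp := fun x hx =>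
    (finComponentRep_apply_eq_self_iff x Tsp).2 fun y => (mem_levelPiece_iff.1 (hTsplev.2 y)).2 x hx
  have hFinv : ∀ g ∈ glFiniteIntegralLevel (n + 1) K, ∀ x ∈ Uf, Ff (g * x) = Ff g := by
    intro g _ x hx
    have h1 : finComponentRep hcpt τ P.1 (g * x) Tsp = finComponentRep hcpt τ P.1 g Tsp := by
      rw [map_mul, Module.End.mul_apply, hfix_sp x hx]
    simp only [hFf, h1, thinIndicatorGL_mul_of_mem_finitePrincipalCongruenceLevel hradius g hx]
  have hFone : Ff 1 = 1 := by
    simp only [hFf, map_one, Module.End.one_apply, hΛsp, map_one, thinIndicatorGL_one, mul_one]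
  have hF1 : Ff 1 ≠ 0 := by rw [hFone]; exact one_ne_zero
  have hFreal : ∀ g, ∃ t : ℝ, 0 ≤ t ∧ Ff g = t := by
    intro g
    rcases thinIndicatorGL_eq_zero_or_one (n := n + 1) (K := K) T m g with h0 | h1
    · exact ⟨0, le_rfl, by simp only [hFf, h0, mul_zero, Complex.ofReal_zero]⟩
    · refine ⟨‖Λ₀ (finComponentRep hcpt τ P.1 g Tsp)‖ ^ 2, sq_nonneg _, ?_⟩
      simp only [hFf, h1, mul_one, Complex.mul_conj, Complex.normSq_eq_norm_sq, Complex.ofReal_pow]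
  -- (7) the averaging datum and the constant `c_F`
  obtain ⟨Q, _, r, q₀, hrU, hrK, havg⟩ :=
    setIntegral_unitBox_univ_eq_avg_mul_integral_map (n := n + 1) hcpt νA νK hUo hUn
  set cF : ℂ := (Fintype.card Q : ℂ)⁻¹ * ∑ q, Ff (r q) with hcF
  have hcF0 : cF ≠ 0 := by
    have hq₀ : Ff (r q₀) = 1 := by
      have h := hFinv 1 (glFiniteIntegralLevel (n + 1) K).one_mem (r q₀) hrU
      rw [one_mul] at h
      rw [h, hFone]
    have hre : 1 ≤ (∑ q, Ff (r q)).re := by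
      rw [Complex.re_sum]
      have hnn : ∀ q ∈ (Finset.univ : Finset Q), 0 ≤ (Ff (r q)).re := fun q _ => by
        obtain ⟨t, ht, h⟩ := hFreal (r q)
        rw [h, Complex.ofReal_re]; exact ht
      have h1 : (Ff (r q₀)).re = 1 := by rw [hq₀, Complex.one_re]
      rw [← h1]
      exact Finset.single_le_sum hnn (Finset.mem_univ q₀)
    have hsum : ∑ q, Ff (r q) ≠ 0 := fun h => by rw [h, Complex.zero_re] at hre; linarith
    haveI : Nonempty Q := ⟨q₀⟩
    exact mul_ne_zero (inv_ne_zero (Nat.cast_ne_zero.2 Fintype.card_ne_zero)) hsum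
  -- (8) the archimedean integrands and the product form on the unit box
  set gk : (Fin (n + 1) → (mixedSpace K)ˣ) × ↥(Kinf (n + 1) K) → GL (Fin (n + 1)) (mixedSpace K) := fun z =>
    glDiagonal (n + 1) (mixedSpace K) z.1 * (z.2 : GL (Fin (n + 1)) (mixedSpace K)) with hgk
  have hgkc : Continuous gk := continuous_glDiagonal_mul_kinf
  set Γ : ((Fin (n + 1) → InfiniteAdeleRing K) → ℂ) → ℂ → (Fin (n + 1) → (mixedSpace K)ˣ) × ↥(Kinf (n + 1) K) → ℂ :=
    fun Φc s z => A (gk z) * conj (A' (gk z)) * Φc (archLastRow (n + 1) K (gk z)) * archTorusWeightC (n + 1) K s z.1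
    with hΓ
  have hΓc : ∀ {Φc : (Fin (n + 1) → InfiniteAdeleRing K) → ℂ}, Continuous Φc → ∀ s, Continuous (Γ Φc s) := by
    intro Φc hΦc s
    exact (((hAc.comp hgkc).mul (Complex.continuous_conj.comp (hA'c.comp hgkc))).mul
      (hΦc.comp (continuous_archLastRow.comp hgkc))).mul ((continuous_archTorusWeightC s).comp continuous_fst)
  have hΨdef : ∀ (Φc : (Fin (n + 1) → InfiniteAdeleRing K) → ℂ) (s : ℂ),
      archRankinSelbergPairIntegralCplx hcpt τ hτc τ hτc ℓi ℓi e e' Φc μA μK s = ∫ z, Γ Φc s z ∂(μA.prod μK) :=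
    fun Φc s => rfl
  have hprodform : ∀ (Φj : (Fin (n + 1) → InfiniteAdeleRing K) → ℝ) (s : ℂ)
      (p : (Fin (n + 1) → ideleGroup K) × ↥(maximalCompactAdelic (n + 1) K)),
      p.1 ∈ unitBox (n := n + 1) (K := K) (Set.univ : Set (HeightOneSpectrum (𝓞 K))) →
        torusPairIntegrandC (n + 1) K W (star W') (thinTestFun (n + 1) K Φj T m) s p =
          Ff (GLn.sndHom (n + 1) K (torusPoint (n + 1) K p)) *
            Γ (fun z => ((Φj z : ℝ) : ℂ)) s (archTorusOfIdele (n + 1) K p.1, kinfOfMaximalCompact (n + 1) K p.2) := by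
    rintro Φj s ⟨a', k'⟩ hp
    have hstar : (star W') (torusPoint (n + 1) K (a', k')) = conj (W' (torusPoint (n + 1) K (a', k'))) := rfl
    simp only [torusPairIntegrandC]
    rw [hstar, hWprod, hW'prod, map_mul, ofReal_thinTestFun_lastRow_eq, torusWeightC_eq_archTorusWeightC s hp,
      toMixed_torusPoint]
    simp only [hΓ, hFf, hgk]
    ring
  -- (9) the unfolding constant and the central character condition
  obtain ⟨C, hC, hunf⟩ :=
    exists_rankinSelbergIntegral_star_eq_mul_rankinSelbergTorusPairIntegralC (n := n + 1) (K := K) hn μ' νI νA νK ν₀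
  have hZ : ∀ z : ideleGroup K, ∃ c : ℂ, ‖c‖ = 1 ∧
      (AdelicGroupData.gl (n + 1) K).rightRegular μ' (Matrix.GeneralLinearGroup.scalar (Fin (n + 1)) z)
          (u : (AdelicGroupData.gl (n + 1) K).L2 μ') = c • (u : (AdelicGroupData.gl (n + 1) K).L2 μ') ∧
      (AdelicGroupData.gl (n + 1) K).rightRegular μ' (Matrix.GeneralLinearGroup.scalar (Fin (n + 1)) z)
          (u' : (AdelicGroupData.gl (n + 1) K).L2 μ') = c • (u' : (AdelicGroupData.gl (n + 1) K).L2 μ') := by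
    intro z
    obtain ⟨ωc, hωcu, -, hact, -, -⟩ := P.exists_centralCharacter
    refine ⟨((ωc z : ℂˣ) : ℂ), hωcu z, ?_, ?_⟩
    · have h := congrArg Subtype.val (hact z u)
      rw [ContRepresentation.ClosedSubrep.coe_toContRep_apply, Submodule.coe_smul] at h
      exact h
    · have h := congrArg Subtype.val (hact z u')
      rw [ContRepresentation.ClosedSubrep.coe_toContRep_apply, Submodule.coe_smul] at h
      exact h
  -- the exceptional set `S' = T` and the good places
  set S' : Set (HeightOneSpectrum (𝓞 K)) := ↑T with hS'
  have hS₁S' : (↑S₁ : Set (HeightOneSpectrum (𝓞 K))) ⊆ S' := fun v hv => hT₀T (Finset.mem_union_left _ hv)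
  have hαS' : IsSatakeFamilyOf P S' α := hα.mono hS₁S'
  have hGood : ∀ v ∉ S', ¬ v.asIdeal ∣ 𝔫 ∧
      (∀ c ∈ 𝒪[v.adicCompletion K], (adeleAddChar K).adicComponent v c = 1) ∧
      ∀ ϖ : v.adicCompletion K, Valued.v ϖ = WithZero.exp (-1 : ℤ) →
        ∃ c ∈ 𝒪[v.adicCompletion K], (adeleAddChar K).adicComponent v (ϖ⁻¹ * c) ≠ 1 := by
    intro v hv
    have hvψ : v ∉ Sψ := fun h => hv (hT₀T (Finset.mem_union_right _ h))
    exact ⟨fun h => hv (hprimes v h), (hSψ v hvψ).1, (hSψ v hvψ).2⟩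
  have hex' : ∀ v : HeightOneSpectrum (𝓞 K), ∃ x : Fin (n + 1) → ℂ,
      v ∉ S' → (Finset.univ : Finset (Fin (n + 1))).val.map x = α v := by
    intro v
    by_cases hv : v ∉ S'
    · obtain ⟨x, hx⟩ := exists_univ_val_map_eq (hαS'.card_eq hv)
      exact ⟨x, fun _ => hx⟩
    · exact ⟨fun _ => 0, fun h => absurd h hv⟩
  choose x hx using hex'
  have h𝓕 : IsFundamentalDomain ↥(rationalUnipotent (n + 1) K) (unipotentTateDomain (n + 1) K) ν₀ :=
    isFundamentalDomain_unipotentTateDomain ν₀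
  have h𝓕c : IsCompact (closure (unipotentTateDomain (n + 1) K)) := isCompact_closure_unipotentTateDomain
  have h𝓕m : MeasurableSet (unipotentTateDomain (n + 1) K) := measurableSet_unipotentTateDomain
  have hpt : Measurable (torusPoint (n + 1) K) := continuous_torusPoint.measurable
  have hWc : Continuous W := continuous_whittakerCoeff h𝓕m h𝓕c hψ.continuous (continuous_invQuot_smoothedForm hηc hηs _)
  have hW'c : Continuous W' := continuous_whittakerCoeff h𝓕m h𝓕c hψ.continuous (continuous_invQuot_smoothedForm hηc hηs _)
  -- (10) ONE PIECE: entire continuation, the strip identity and the integrability of the archimedean integrand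
  have piece : ∀ (Φj : (Fin (n + 1) → InfiniteAdeleRing K) → ℝ), Continuous Φj → (∀ z, 0 ≤ Φj z) →
      (∃ Sj : SchwartzMap (Fin (n + 1) → mixedSpace K) ℂ, ∀ z : Fin (n + 1) → InfiniteAdeleRing K,
        ((Φj z : ℝ) : ℂ) = Sj fun j => InfiniteAdeleRing.ringEquiv_mixedSpace K (z j)) →
      ∃ Fj : ℂ → ℂ, Differentiable ℂ Fj ∧
        (∀ s : ℂ, 1 < s.re → s.re < 2 → Fj s = s * (s - 1) * ((C : ℂ) *
          (partialPairL S' α (conjFamily α) s *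
            (cF * archRankinSelbergPairIntegralCplx hcpt τ hτc τ hτc ℓi ℓi e e' (fun z => ((Φj z : ℝ) : ℂ)) μA μK s)))) ∧
        ∀ s : ℂ, 1 < s.re → Integrable (Γ (fun z => ((Φj z : ℝ) : ℂ)) s) (μA.prod μK) := by
    intro Φj hΦjc hΦj0 hSj
    obtain ⟨Sj, hSj⟩ := hSj
    set Φ : (Fin (n + 1) → AdeleRing (𝓞 K) K) → ℝ := thinTestFun (n + 1) K Φj T m with hΦdef
    have hΦS : (fun y => (Φ y : ℂ)) ∈ piSchwartzBruhat K (Fin (n + 1)) := ofReal_thinTestFun_mem_piSchwartzBruhat hSj T m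
    have hΦ0 : ∀ y, 0 ≤ Φ y := fun y => thinTestFun_nonneg hΦj0 T m y
    have hΦc : Continuous Φ := continuous_thinTestFun_of_continuous hΦjc T m
    have hΦm : Measurable fun g : GL (Fin (n + 1)) (AdeleRing (𝓞 K) K) => Φ (lastRow (n + 1) K g) :=
      (hΦc.comp continuous_lastRow).measurable
    -- the entire continuation of `s (s - 1) I_j(s)`
    obtain ⟨Fj, hFj, hFjI, -⟩ := exists_entire_eq_mul_rankinSelbergIntegral_star_of_ne hn μ' νI P P u u' hη hΦS
    -- finiteness of the real torus integrals and integrability of the pair integrand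
    have hfin : ∀ s : ℂ, 1 < s.re → rankinSelbergTorusIntegral (n + 1) K νA νK W Φ s.re ≠ ⊤ := fun s hs =>
      rankinSelbergTorusIntegral_whittakerCoeff_ne_top_of_mem_piSchwartzBruhat hn νA νK ν₀ P u hη hΦS hΦ0 hΦm hs
    have hfin' : ∀ s : ℂ, 1 < s.re → rankinSelbergTorusIntegral (n + 1) K νA νK W' Φ s.re ≠ ⊤ := fun s hs =>
      rankinSelbergTorusIntegral_whittakerCoeff_ne_top_of_mem_piSchwartzBruhat hn νA νK ν₀ P u' hη hΦS hΦ0 hΦm hs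
    have hfin'' : ∀ s : ℂ, 1 < s.re → rankinSelbergTorusIntegral (n + 1) K νA νK (star W') Φ s.re ≠ ⊤ := fun s hs => by
      rw [rankinSelbergTorusIntegral_star]; exact hfin' s hs
    have hIint : ∀ s : ℂ, 1 < s.re → Integrable (torusPairIntegrandC (n + 1) K W (star W') Φ s) (νA.prod νK) := by
      intro s hs
      refine integrable_torusPairIntegrandC νA νK hΦ0 ?_ (measurable_torusIntegrand hWc hΦm s.re)
        (measurable_torusIntegrand hW'c.star hΦm s.re) (hfin s hs) (hfin'' s hs)
      exact (measurable_torusPairIntegrandC (hWc.measurable.comp hpt) (hW'c.star.measurable.comp hpt) (hΦm.comp hpt) s).aestronglyMeasurable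
    -- integrability of the archimedean integrand on the unit box and for the image measures
    have hΓj : ∀ s : ℂ, Continuous (Γ (fun z => ((Φj z : ℝ) : ℂ)) s) := fun s =>
      hΓc (Φc := fun z => ((Φj z : ℝ) : ℂ)) (Complex.continuous_ofReal.comp hΦjc) s
    have hintbox : ∀ s : ℂ, 1 < s.re → IntegrableOn (fun p : (Fin (n + 1) → ideleGroup K) × ↥(maximalCompactAdelic (n + 1) K) =>
        Γ (fun z => ((Φj z : ℝ) : ℂ)) s (archTorusOfIdele (n + 1) K p.1, kinfOfMaximalCompact (n + 1) K p.2))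
        (unitBox (Set.univ : Set (HeightOneSpectrum (𝓞 K))) ×ˢ Set.univ) (νA.prod νK) := fun s hs =>
      integrableOn_unitBox_univ_of_productForm hcpt νA νK hUo hUn Ff hFinv hF1
        (hΓj s) _ (hprodform Φj s) (hIint s hs).integrableOn
    have hintarch : ∀ s : ℂ, 1 < s.re → Integrable (Γ (fun z => ((Φj z : ℝ) : ℂ)) s) (μA.prod μK) := by
      intro s hs
      rw [hμA, hμK]
      exact (integrable_map_prod_map_iff_integrableOn_unitBox νA νK (hΓj s)).2 (hintbox s hs)
    refine ⟨Fj, hFj, fun s hs1 hs2 => ?_, hintarch⟩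
    -- the strip identity: unfold, factor, collapse, average
    have hbad : ∫ p in unitBox {v | v ∉ S'} ×ˢ Set.univ, torusPairIntegrandC (n + 1) K W (star W') Φ s p ∂(νA.prod νK) =
        cF * archRankinSelbergPairIntegralCplx hcpt τ hτc τ hτc ℓi ℓi e e' (fun z => ((Φj z : ℝ) : ℂ)) μA μK s := by
      rw [hΦdef, setIntegral_torusPairIntegrandC_thin_eq_unitBox_univ hWN hWZ hm hdata (star W') Φj s νA νK,
        havg Ff hFinv (Γ := Γ (fun z => ((Φj z : ℝ) : ℂ)) s) (hΓj s) (hintbox s hs1) _ (hprodform Φj s),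
        hΨdef, hμA, hμK]
    rw [hFjI s hs1, hunf P P u u' hZ hη hΦS hΦ0 hΦm hs1 hs2,
      rankinSelbergTorusPairIntegralC_whittakerCoeff_thin_eq_partialPairL_mul hn P P hα hα h𝔫 hηc hηs hηK u u'
        h𝓕 h𝓕m h𝓕c hψ m hS₁S' subset_rfl hGood (fun v hv => hx v hv) (fun v hv => hx v hv) hΦj0 hΦm νA νK hs1
        (hfin s hs1) (hfin' s hs1), hbad]
    rfl
  -- (11) the four pieces, linearity, the inverse Gamma factor, and the entire function
  have hP₁ := hpieces Φ₁ (by simp)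
  have hP₂ := hpieces Φ₂ (by simp)
  have hP₃ := hpieces Φ₃ (by simp)
  have hP₄ := hpieces Φ₄ (by simp)
  obtain ⟨F₁, hF₁, hF₁s, hi₁⟩ := piece Φ₁ hP₁.1 hP₁.2.1 hP₁.2.2
  obtain ⟨F₂, hF₂, hF₂s, hi₂⟩ := piece Φ₂ hP₂.1 hP₂.2.1 hP₂.2.2
  obtain ⟨F₃, hF₃, hF₃s, hi₃⟩ := piece Φ₃ hP₃.1 hP₃.2.1 hP₃.2.2
  obtain ⟨F₄, hF₄, hF₄s, hi₄⟩ := piece Φ₄ hP₄.1 hP₄.2.1 hP₄.2.2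
  have hlin : ∀ s : ℂ, 1 < s.re →
      archRankinSelbergPairIntegralCplx hcpt τ hτc τ hτc ℓi ℓi e e' Φi μA μK s =
        (archRankinSelbergPairIntegralCplx hcpt τ hτc τ hτc ℓi ℓi e e' (fun z => ((Φ₁ z : ℝ) : ℂ)) μA μK s -
          archRankinSelbergPairIntegralCplx hcpt τ hτc τ hτc ℓi ℓi e e' (fun z => ((Φ₂ z : ℝ) : ℂ)) μA μK s) +
        Complex.I * (archRankinSelbergPairIntegralCplx hcpt τ hτc τ hτc ℓi ℓi e e' (fun z => ((Φ₃ z : ℝ) : ℂ)) μA μK s -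
          archRankinSelbergPairIntegralCplx hcpt τ hτc τ hτc ℓi ℓi e e' (fun z => ((Φ₄ z : ℝ) : ℂ)) μA μK s) := by
    intro s hs
    refine archRankinSelbergPairIntegralCplx_decomposition hcpt τ hτc τ hτc ℓi ℓi e e' hdecomp μA μK s ?_
    intro Ψ hΨ
    simp only [List.mem_cons, List.mem_nil_iff, or_false] at hΨ
    rcases hΨ with rfl | rfl | rfl | rfl
    · exact hi₁ s hs
    · exact hi₂ s hs
    · exact hi₃ s hs
    · exact hi₄ s hs
  obtain ⟨Einv, hEinv, hEH⟩ := exists_entire_inv_gammaFactor hcH a b ha hb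
  have hEH' : ∀ s : ℂ, 1 < s.re → Einv s * archRankinSelbergPairIntegralCplx hcpt τ hτc τ hτc ℓi ℓi e e' Φi μA μK s = 1 :=
    fun s hs => by rw [hHJ' s hs]; exact hEH s hs
  have hL : DifferentiableOn ℂ (partialPairL S' α (conjFamily α)) {s : ℂ | 1 < s.re} :=
    differentiableOn_partialPairL_conjFamily P hαS'
  obtain ⟨G, hG, hGeq⟩ := exists_entire_eq_of_pieces (L := partialPairL S' α (conjFamily α))
    (Complex.ofReal_ne_zero.2 hC.ne') hcF0 hF₁ hF₂ hF₃ hF₄ hF₁s hF₂s hF₃s hF₄s hlin hEinv hEH' hL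
  exact ⟨S', α, T.finite_toSet, hαS', G, hG, hGeq⟩

/-! ### Arthur–Clozel (2.3) from Humphries–Jo -/

/-- **Jacquet–Shalika / Arthur–Clozel (2.3) in rank `n + 1` from Humphries–Jo's archimedean test
vectors.** The named fact `JacquetShalika1981_partialPairL_pole_of_eq_conj` — for unitary cuspidal
`π ≅ σ̃` on `GL_{n+1}(𝔸_K)` with Satake families `α`, `β` off a finite `S`, `(s - 1) L^S(s, π ⊗ σ) → c ≠ 0`
as `s → 1⁺` — follows from `HumphriesJo2024_archRankinSelberg_testVector (n + 1) K`: the continuation `G`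
of `exists_entire_eq_partialPairL_conjFamily_of_humphriesJo` has `G(1) ≠ 0` by Landau's lemma
(`partialPairL_conjFamily_continuation_apply_one_ne_zero`), which is the one-family datum of
`JacquetShalika1981_partialPairL_pole_of_eq_conj_of_one_family'` ((2.1) and the strict Satake bound
being theorems of the tree). [cite: ArthurClozelAMS120, Ch. 3 §2 (2.3)]
[cite: JacquetShalikaAJM1981, Thm. (5.3) and its proof, p. 556; II Prop. (3.6)]
[cite: HumphriesJo2024, Thm. 1.1, Thm. 5.6] -/
theorem JacquetShalika1981_partialPairL_pole_of_eq_conj_of_humphriesJo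
    (hHJ : HumphriesJo2024_archRankinSelberg_testVector (n + 1) K) :
    JacquetShalika1981_partialPairL_pole_of_eq_conj (n := n + 1) (K := K) (μ := μ') := by
  refine JacquetShalika1981_partialPairL_pole_of_eq_conj_of_one_family'
    JacquetShalika1981_multipliable_partialPairL_holds
    (fun P _ _ hα _ hv _ ha => norm_satakeParameter_lt_sqrt_of_isGeneric
      exists_hasLocalComponentAt_holds Flath1979_isSatakeParameter_of_hasLocalComponentAt_holds
      Shalika1974_isGeneric_of_hasLocalComponentAt_holds
      (fun _ _ _ _ _ => JacquetShalika1981_norm_lt_sqrt_of_isGeneric_holds) P hα hv ha) fun hn P => ?_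
  obtain ⟨S', α, hS', hα, G, hG, hGeq⟩ := exists_entire_eq_partialPairL_conjFamily_of_humphriesJo (μ' := μ') hHJ P
  have hG1 : G 1 ≠ 0 := partialPairL_conjFamily_continuation_apply_one_ne_zero hn P hS' hα hG hGeq
  refine ⟨S', α, hS', hα, G 1, hG1, ?_⟩
  -- `(s - 1) L^{S'}(s) = G s / s → G 1 / 1`
  have hGc : Tendsto G (𝓝[{s : ℂ | 1 < s.re}] 1) (𝓝 (G 1)) :=
    (hG 1).continuousAt.tendsto.mono_left nhdsWithin_le_nhds
  have hid : Tendsto (fun s : ℂ => s) (𝓝[{s : ℂ | 1 < s.re}] 1) (𝓝 1) :=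
    (continuous_id.tendsto 1).mono_left nhdsWithin_le_nhds
  have hdiv : Tendsto (fun s : ℂ => G s / s) (𝓝[{s : ℂ | 1 < s.re}] 1) (𝓝 (G 1 / 1)) :=
    hGc.div hid one_ne_zero
  rw [div_one] at hdiv
  refine hdiv.congr' ?_
  filter_upwards [self_mem_nhdsWithin] with s hs
  have hs1 : 1 < s.re := hs
  have hs0 : s ≠ 0 := by
    rintro rfl
    rw [Complex.zero_re] at hs1
    linarith
  rw [hGeq s hs1, mul_assoc, mul_div_cancel_left₀ _ hs0]

end Main

/-! ### Every rank -/

section AllRanks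

variable {K : Type} [Field K] [NumberField K]

/-- **Arthur–Clozel (2.3) in every rank from Humphries–Jo** (rank `0` is excluded by the hypothesis
`0 < n` of the fact). [cite: ArthurClozelAMS120, Ch. 3 §2 (2.3)] [cite: HumphriesJo2024, Thm. 1.1, Thm. 5.6] -/
theorem JacquetShalika1981_partialPairL_pole_of_eq_conj_of_humphriesJo' {N : ℕ}
    {μ : Measure (AdelicGroupData.gl N K).automorphicQuotient} [(AdelicGroupData.gl N K).IsAutomorphicMeasure μ]
    (hHJ : HumphriesJo2024_archRankinSelberg_testVector N K) :
    JacquetShalika1981_partialPairL_pole_of_eq_conj (n := N) (K := K) (μ := μ) := by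
  cases N with
  | zero => intro hn; exact absurd hn (lt_irrefl 0)
  | succ n => exact JacquetShalika1981_partialPairL_pole_of_eq_conj_of_humphriesJo hHJ

end AllRanks

end Literature.NumberTheory.Automorphic
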